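import Summits.Langlands.Langlands.Theses.ParityBlindBianchi

/-!
# Crux-strategist r1 (REDIRECT lane) — position certificate for
# `ParityBlindBianchi.QuadraticDescentGL2` (QD, item stmt-Langlands-16811)

Unit `cstrat-stmt-Langlands-16811-r1` (planner-cstrat-stmt-Langlands-16811-r1-0), 2026-08-17.
Companion of `Cruxes/QuadraticDescentGL2/STRATEGY-CENSUS.md` (strategist r1). Sorry-free.

What is certified here, BY NAME against the live route file (rev 18):

* `crux_of_fact` : QD is the `n = 2`, `[E:F] = 2` instance of the tree's NAMED LITERATURE FACT
  `Literature.NumberTheory.Automorphic.cuspidal_descent_cyclic` (Arthur–Clozel 1989, Ch. 3 Thm 4.2 (d);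
  Langlands 1980 for `n = 2`): `finrank F E = 2` gives a prime degree and a cyclic Galois group. So QD is
  bounded above by ONE theorem in print — it has no open content; in particular it is STRICTLY WEAKER than
  the summit `Langlands` (global reciprocity for every `GL_n`, open), which no cheap tactic and no landed
  theorem derives from it (probe files `bc/QD_to_S_probe.lean`, `bc/CruxProbe.lean` P5: all fail).
* `closes_of_fact` : the route's deciding theorem with the QD binder discharged by that fact — i.e. the
  only thing QD adds to `closes` over the vendored fact is the harness ruling that XL-apex facts are not
  citable in closes-serving proofs (route-choice a6bd8d4f / bc22de8d), not mathematics.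

Nothing here is new mathematics (the same instance was kernel-checked by the grounder, cand_16811.lean,
and by the refuter, Probe_QuadraticDescentGL2.lean, against rev 13); it is re-checked against rev 18 so
that the tribunal has one importable statement to cite.
-/

noncomputable section

-- `Summit.Langlands.Langlands.…`: summit = sub-problem name (D-0017 nested layout), not a typo.
set_option linter.dupNamespace false

namespace Summit.Langlands.Langlands.Cruxes.QuadraticDescentGL2.StrategistR1

open Summit.Langlands.Langlands.Theses.ParityBlindBianchi
open Literature.NumberTheory.Automorphic

/-- **QD ⟸ cyclic descent of prime degree (named fact), at `n = 2`, `[E:F] = 2`.** [folklore] -/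
theorem crux_of_fact (h : cuspidal_descent_cyclic) : QuadraticDescentGL2 := by
  intro F E _ _ _ _ _ _ h2 hF hE P hP
  haveI : FiniteDimensional F E := Module.finite_of_finrank_eq_succ h2
  have hprime : (Module.finrank F E).Prime := by rw [h2]; exact Nat.prime_two
  have hcyc : IsCyclic (E ≃ₐ[F] E) := by
    haveI : Fact (Module.finrank F E).Prime := ⟨hprime⟩
    exact isCyclic_of_prime_card (IsGalois.card_aut_eq_finrank F E)
  exact h 2 F E hF hE hcyc hprime P hP

/-- **The deciding theorem with QD discharged by the named fact**: modulo `cuspidal_descent_cyclic`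
the route needs only its six other cruxes. [folklore] -/
theorem closes_of_fact (h : cuspidal_descent_cyclic) (hQBC : QuadraticBaseChangeGL2)
    (hE1 : ResidualBianchiDoorLevelBC) (hE2 : TwoAdicBianchiProModularityLevel)
    (hR : ArtinWeightRealisationEven) (hD : IcosahedralDescentLevelBC)
    (hJ : EvenArtinJunction) : _root_.Langlands :=
  closes (crux_of_fact h) hQBC hE1 hE2 hR hD hJ

end Summit.Langlands.Langlands.Cruxes.QuadraticDescentGL2.StrategistR1

end
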